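import Summits.KontsevichZagierPeriods.KontsevichZagierPeriods.Theses.IsogenyCertificates
import Summits.KontsevichZagierPeriods.KontsevichZagierPeriods.Theorems.EffectiveXMapChains.Negative.CountedTransfer
import Summits.KontsevichZagierPeriods.KontsevichZagierPeriods.Theorems.EffectiveXMapChains.Negative.Mechanism
import Summits.KontsevichZagierPeriods.KontsevichZagierPeriods.Theorems.EffectiveXMapChains.Negative.PeriodRep
import Summits.KontsevichZagierPeriods.KontsevichZagierPeriods.Theorems.EffectiveXMapChains.Negative.LimitValue
import Literature.NumberTheory.Transcendental.KZRelationsLE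
import Literature.NumberTheory.Transcendental.SemialgebraicMapsProofs
import Literature.ModelTheory.ExponentialFields.SemialgebraicComponents
import Summits.KontsevichZagierPeriods.KontsevichZagierPeriods.Theorems.IsogenyCertificatesXMapPeriodTransferCellsBasic

/-!
# `EffectiveXMapChains` (stmt-KontsevichZagierPeriods-10664, route IsogenyCertificates) — line
`full-component-sheets`, stub `stub_dissection`

Write `P = X³ + AX + B`, `W = f'g − fg'` (`f, g ∈ ℚ[X]`, `W ≠ 0`), `S = {P > 0, g ≠ 0, W ≠ 0} ⊆ ℝ` (the SHEET
SET). For an admissible domain `D` (open union of components of `{P > 0}`, `ℚ`-semialgebraic lift to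
`ℝ¹`) and any KZ representation `r` of dimension `1` on the lift of `D`, the stub dissects `r` along
the PIECES (components `K_t` of `S`) inside `D`: `[r] ≡ Σ_{t ∈ T} [r|K_t]` by `≤ T.card + 4`
domain-additivity moves in dimension `1`, `T` a transversal of the pieces meeting `D`, `T.card ≤ 3N + 4`.

Proof. The cut set `D ∖ S` lies in the real zero set of the nonzero polynomial `P·g·W`, so its lift is
finite and Lebesgue-null: one move splits `[r]` into `[r|S ∩ D] + [r|D ∖ S]`, one move kills the null
piece. The pieces are open intervals, finitely many: the infimum of a bounded-below piece is a frontier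
point of `S`, hence a root of `P·g·W`, distinct pieces have distinct infima, and at most one piece is
unbounded below (`Dissection.finite_components`); so `#pieces ≤ deg (P·g·W) + 1 ≤ 3N + 4`. Peeling the
pieces off is finite domain additivity (`Dissection.chainLE_sub_sum`, `T.card + 1` moves); the lifted
pieces are `ℚ`-semialgebraic by Basu–Pollack–Roy Thm. 5.22 transported along `ℝ¹ ≃ₜ ℝ` (tree file
`IsogenyCertificatesXMapPeriodTransferCellsBasic`: `hat_connectedComponentIn`,
`isSemialgebraic_hat_connectedComponentIn`, `aeval_aeval_X_zero`).

References: Kontsevich–Zagier, *Periods* (2001), §1.2 rule (1); Basu–Pollack–Roy (2006), Thm. 5.22.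
-/

noncomputable section

open Polynomial Set MeasureTheory
open Literature.NumberTheory.Transcendental Literature.ModelTheory.ExponentialFields
open Summit.KontsevichZagierPeriods.IsogenyCertificates.EffectiveXMapChainsNegative
open Summit.KontsevichZagierPeriods.IsogenyCertificates.XMapPeriodTransferCells
  (isSemialgebraic_hat_connectedComponentIn aeval_aeval_X_zero)

namespace Summit.KontsevichZagierPeriods.IsogenyCertificates.EffectiveXMapChainsLine

namespace Dissection

/-- The lift of the sheet set `{P > 0, g ≠ 0, W ≠ 0}` to `ℝ¹` is `ℚ`-semialgebraic. [folklore] -/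
theorem isSemialgebraic_lift_sheet (A B : ℤ) (g W : ℚ[X]) :
    IsSemialgebraic ℚ {x : Fin 1 → ℝ | x 0 ∈ {y : ℝ | 0 < y ^ 3 + (A : ℝ) * y + (B : ℝ) ∧
      aeval y g ≠ 0 ∧ aeval y W ≠ 0}} := by
  have h1 := isSemialgebraic_domain A B
  have h2 := isSemialgebraic_setOf_eval_ne_zero (R := ℝ)
    (aeval (MvPolynomial.X 0 : MvPolynomial (Fin 1) ℚ) g)
  have h3 := isSemialgebraic_setOf_eval_ne_zero (R := ℝ)
    (aeval (MvPolynomial.X 0 : MvPolynomial (Fin 1) ℚ) W)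
  convert h1.inter (h2.inter h3) using 1
  ext x
  simp only [mem_setOf_eq, mem_inter_iff, aeval_aeval_X_zero]

/-- **Pieces of an open subset of `ℝ` with finite frontier.** If `S ⊆ ℝ` is open and
`closure S ∖ S ⊆ R` for a finite `R`, then `S` has finitely many connected components, at most
`R.card + 1`: each component is an open interval; the infimum of a bounded-below component is not
in it (openness) and not in `S` (an interval of `S` around it would meet, hence lie in, the
component), so it lies in `R`; components with the same infimum meet, hence coincide, and two
components unbounded below meet as well. [folklore] -/
theorem finite_components {S : Set ℝ} (hS : IsOpen S) (R : Finset ℝ)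
    (hR : closure S \ S ⊆ (R : Set ℝ)) :
    {K : Set ℝ | ∃ x ∈ S, K = connectedComponentIn S x}.Finite ∧
      {K : Set ℝ | ∃ x ∈ S, K = connectedComponentIn S x}.ncard ≤ R.card + 1 := by
  set Comps : Set (Set ℝ) := {K : Set ℝ | ∃ x ∈ S, K = connectedComponentIn S x} with hComps
  have hne : ∀ K ∈ Comps, K.Nonempty := by
    rintro K ⟨x, hx, rfl⟩
    exact ⟨x, mem_connectedComponentIn hx⟩
  have hKS : ∀ K ∈ Comps, K ⊆ S := by
    rintro K ⟨x, -, rfl⟩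
    exact connectedComponentIn_subset _ _
  -- a component reaching below and above a point of another component is that component
  have hmeet : ∀ K ∈ Comps, ∀ K' ∈ Comps, ∀ z ∈ K', (∃ v ∈ K, v ≤ z) → (∃ y ∈ K, z ≤ y) →
      K = K' := by
    rintro K ⟨x, -, rfl⟩ K' ⟨x', -, rfl⟩ z hz ⟨v, hv, hvz⟩ ⟨y, hy, hzy⟩
    have hzK := isPreconnected_connectedComponentIn.ordConnected.out hv hy ⟨hvz, hzy⟩
    exact (connectedComponentIn_eq hzK).trans (connectedComponentIn_eq hz).symm
  -- the infimum of a bounded-below component is a strict lower bound (components are open) ...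
  have hlt : ∀ K ∈ Comps, BddBelow K → ∀ y ∈ K, sInf K < y := by
    rintro K ⟨x, -, rfl⟩ hb y hy
    refine lt_of_le_of_ne (csInf_le hb hy) fun he => ?_
    have hmem : sInf (connectedComponentIn S x) ∈ connectedComponentIn S x := by
      rw [he]; exact hy
    obtain ⟨l, u, ⟨hl, hu⟩, hsub⟩ :=
      mem_nhds_iff_exists_Ioo_subset.mp (hS.connectedComponentIn.mem_nhds hmem)
    obtain ⟨m, hlm, hma⟩ := exists_between hl
    exact absurd hma (not_lt.mpr (csInf_le hb (hsub ⟨hlm, hma.trans hu⟩)))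
  -- ... and lies in `R`
  have hinfR : ∀ K ∈ Comps, BddBelow K → sInf K ∈ (R : Set ℝ) := by
    intro K hK hb
    refine hR ⟨closure_mono (hKS K hK) (csInf_mem_closure (hne K hK) hb), fun haS => ?_⟩
    obtain ⟨l, u, ⟨hl, hu⟩, hsub⟩ := mem_nhds_iff_exists_Ioo_subset.mp (hS.mem_nhds haS)
    obtain ⟨y, hyK, hyu⟩ := exists_lt_of_csInf_lt (hne K hK) hu
    have hly : l < y := hl.trans (hlt K hK hb y hyK)
    have hIoo : Ioo l u ⊆ K := by
      have hK' := hK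
      obtain ⟨x, -, rfl⟩ := hK'
      rw [connectedComponentIn_eq hyK]
      exact isPreconnected_Ioo.subset_connectedComponentIn ⟨hly, hyu⟩ hsub
    exact lt_irrefl _ (hlt K hK hb _ (hIoo ⟨hl, hu⟩))
  -- bounded-below components inject into `R` by `sInf`; at most one is unbounded below
  set CB : Set (Set ℝ) := {K ∈ Comps | BddBelow K} with hCB
  set CU : Set (Set ℝ) := {K ∈ Comps | ¬BddBelow K} with hCU
  have hunion : Comps ⊆ CB ∪ CU := fun K hK =>
    (Classical.em (BddBelow K)).elim (fun h => Or.inl ⟨hK, h⟩) fun h => Or.inr ⟨hK, h⟩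
  have hmaps : ∀ K ∈ CB, sInf K ∈ (R : Set ℝ) := fun K hK => hinfR K hK.1 hK.2
  have hinj : InjOn sInf CB := by
    rintro K ⟨hK, hb⟩ K' ⟨hK', hb'⟩ he
    obtain ⟨y, hy⟩ := hne K hK
    obtain ⟨z, hz, hzy⟩ := exists_lt_of_csInf_lt (hne K' hK')
      (show sInf K' < y by rw [← he]; exact hlt K hK hb y hy)
    obtain ⟨v, hv, hvz⟩ := exists_lt_of_csInf_lt (hne K hK)
      (show sInf K < z by rw [he]; exact hlt K' hK' hb' z hz)
    exact hmeet K hK K' hK' z hz ⟨v, hv, hvz.le⟩ ⟨y, hy, hzy.le⟩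
  have hsubs : CU.Subsingleton := by
    rintro K ⟨hK, hb⟩ K' ⟨hK', hb'⟩
    rw [not_bddBelow_iff] at hb hb'
    obtain ⟨y, hy⟩ := hne K hK
    obtain ⟨z, hz, hzy⟩ := hb' y
    obtain ⟨v, hv, hvz⟩ := hb z
    exact hmeet K hK K' hK' z hz ⟨v, hv, hvz.le⟩ ⟨y, hy, hzy.le⟩
  have hCBfin : CB.Finite := Set.Finite.of_injOn (fun K hK => hmaps K hK) hinj R.finite_toSet
  have hCUfin : CU.Finite := hsubs.finite
  have hfin : Comps.Finite := (hCBfin.union hCUfin).subset hunion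
  refine ⟨hfin, (Set.ncard_le_ncard hunion (hCBfin.union hCUfin)).trans
    ((Set.ncard_union_le _ _).trans (add_le_add ?_ ?_))⟩
  · exact (Set.ncard_le_ncard_of_injOn sInf (fun K hK => hmaps K hK) hinj
      R.finite_toSet).trans_eq (Set.ncard_coe_finset R)
  · exact (Set.ncard_le_one hCUfin).mpr fun a ha b hb => hsubs ha hb

/-- **Finite domain additivity (peeling).** If `r.domain` is the union of the domains of the
`ρ i`, `i ∈ U`, with pairwise null intersections and integrands agreeing with `r.integrand`, then
`[r] − Σ_{i ∈ U} [ρ i]` is a chain of `U.card + 1` domain-additivity moves in the dimension of `r`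
(peel one piece at a time; an empty domain is minus one move `∅ = ∅ ∪ ∅`).
[cite: KontsevichZagier2001, §1.2 rule (1)] -/
theorem chainLE_sub_sum {n : ℕ} {ι : Type*} (ρ : ι → KZ.IntegralRep n) (U : Finset ι) :
    ∀ r : KZ.IntegralRep n, r.domain = ⋃ i ∈ U, (ρ i).domain →
      (∀ i ∈ U, ∀ j ∈ U, i ≠ j → volume ((ρ i).domain ∩ (ρ j).domain) = 0) →
      (∀ i ∈ U, EqOn r.integrand (ρ i).integrand (ρ i).domain) →
      KZ.ChainLE n (U.card + 1) (KZ.of r - ∑ i ∈ U, KZ.of (ρ i)) := by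
  classical
  induction U using Finset.induction_on with
  | empty =>
    intro r hdom _ _
    have h0 : r.domain = ∅ := by simpa using hdom
    have hmem : -KZ.of r ∈ KZ.domainAddRel :=
      ⟨n, r, r, r, (union_self _).symm, by rw [inter_self, h0, measure_empty],
        fun _ _ => rfl, fun _ _ => rfl, by abel⟩
    have h1 : KZ.ChainLE n 1 (KZ.of r) :=
      KZ.ChainLE.of_neg_mem_movesLE ⟨Or.inl (Or.inl (Or.inl hmem)),
        neg_mem (KZ.of_mem_formalRepLE r le_rfl)⟩
    simpa using h1
  | insert a U ha ih =>
    intro r hdom hdisj hint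
    rw [Finset.set_biUnion_insert] at hdom
    have hsa : IsSemialgebraic ℚ (⋃ i ∈ U, (ρ i).domain) :=
      IsSemialgebraic.biUnion U _ fun i _ => (ρ i).isSemialgebraic_domain
    have hsub : (⋃ i ∈ U, (ρ i).domain) ⊆ r.domain := by
      rw [hdom]; exact subset_union_right
    set r₂ : KZ.IntegralRep n := r.restrict (⋃ i ∈ U, (ρ i).domain) hsa hsub with hr₂
    have hnull : volume ((ρ a).domain ∩ ⋃ i ∈ U, (ρ i).domain) = 0 := by
      rw [inter_iUnion₂]
      refine nonpos_iff_eq_zero.mp ((measure_biUnion_finset_le U _).trans (Finset.sum_eq_zero ?_).le)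
      intro i hi
      exact hdisj a (Finset.mem_insert_self a U) i (Finset.mem_insert_of_mem hi)
        fun h => ha (h ▸ hi)
    have hmem : KZ.of r - KZ.of (ρ a) - KZ.of r₂ ∈ KZ.domainAddRel :=
      ⟨n, r, ρ a, r₂, hdom, hnull, hint a (Finset.mem_insert_self a U), fun _ _ => rfl, rfl⟩
    have h1 : KZ.ChainLE n 1 (KZ.of r - KZ.of (ρ a) - KZ.of r₂) :=
      KZ.ChainLE.of_mem_movesLE ⟨Or.inl (Or.inl (Or.inl hmem)),
        sub_mem (sub_mem (KZ.of_mem_formalRepLE r le_rfl) (KZ.of_mem_formalRepLE _ le_rfl))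
          (KZ.of_mem_formalRepLE r₂ le_rfl)⟩
    have h2 := ih r₂ rfl
      (fun i hi j hj => hdisj i (Finset.mem_insert_of_mem hi) j (Finset.mem_insert_of_mem hj))
      fun i hi => hint i (Finset.mem_insert_of_mem hi)
    have h := h1.add h2
    have e : KZ.of r - KZ.of (ρ a) - KZ.of r₂ + (KZ.of r₂ - ∑ i ∈ U, KZ.of (ρ i)) =
        KZ.of r - (KZ.of (ρ a) + ∑ i ∈ U, KZ.of (ρ i)) := by abel
    rw [e] at h
    rw [Finset.sum_insert ha, Finset.card_insert_of_notMem ha]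
    exact h.mono le_rfl (by omega)

end Dissection

/-- **Stub (dissection into pieces).** For a datum `(f, g)` with `W = f'g − fg' ≠ 0`, an
admissible domain `D ⊆ {P > 0}` (open union of components, `ℚ`-semialgebraic lift) and any
representation `r` on the lift of `D`: there are a transversal `T ⊆ S ∩ D` of the pieces (connected
components of the sheet set `S = {P > 0, g ≠ 0, W ≠ 0}`) meeting `D`, of size `≤ 3N + 4`, and the
restrictions `ρ t = r|K_t` (same integrand), with `[r] − Σ_{t ∈ T} [ρ t]` a chain of `≤ T.card + 4`
moves in dimension `1` (cut out the finite set `D ∖ S`, kill it, peel the pieces).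
[cite: KontsevichZagier2001, §1.2 rule (1)] -/
theorem stub_dissection (A B : ℤ) (f g : ℚ[X]) (hW : derivative f * g - f * derivative g ≠ 0) (D : Set ℝ) (hD : D ⊆ {x : ℝ | 0 < x ^ 3 + (A : ℝ) * x + (B : ℝ)}) (hDopen : IsOpen D) (hsat : ∀ x ∈ D, connectedComponentIn {x : ℝ | 0 < x ^ 3 + (A : ℝ) * x + (B : ℝ)} x ⊆ D) (hDsa : IsSemialgebraic ℚ {x : Fin 1 → ℝ | x 0 ∈ D}) (r : KZ.IntegralRep 1) (hr : r.domain = {x : Fin 1 → ℝ | x 0 ∈ D}) : ∃ (T : Finset ℝ) (ρ : ℝ → KZ.IntegralRep 1), (∀ t ∈ T, t ∈ D ∧ t ∈ {x : ℝ | 0 < x ^ 3 + (A : ℝ) * x + (B : ℝ) ∧ aeval x g ≠ 0 ∧ aeval x (derivative f * g - f * derivative g) ≠ 0}) ∧ (∀ t ∈ T, (ρ t).domain = {x : Fin 1 → ℝ | x 0 ∈ connectedComponentIn {x : ℝ | 0 < x ^ 3 + (A : ℝ) * x + (B : ℝ) ∧ aeval x g ≠ 0 ∧ aeval x (derivative f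 * g - f * derivative g) ≠ 0} t} ∧ (ρ t).integrand = r.integrand) ∧ T.card ≤ 3 * max f.natDegree g.natDegree + 4 ∧ KZ.ChainLE 1 (T.card + 4) (KZ.of r - ∑ t ∈ T, KZ.of (ρ t)) := by
  classical
  -- `hDopen`, `hDsa` are part of the registered interface (admissibility of `D`) but are not
  -- needed: the pieces are components of the sheet set, whose lift is semialgebraic on its own.
  have _hunused : IsOpen D ∧ IsSemialgebraic ℚ {x : Fin 1 → ℝ | x 0 ∈ D} := ⟨hDopen, hDsa⟩
  set W : ℚ[X] := derivative f * g - f * derivative g with hWdef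
  set F : Set ℝ := {x : ℝ | 0 < x ^ 3 + (A : ℝ) * x + (B : ℝ)} with hFdef
  set S : Set ℝ := {x : ℝ | 0 < x ^ 3 + (A : ℝ) * x + (B : ℝ) ∧ aeval x g ≠ 0 ∧ aeval x W ≠ 0}
    with hSdef
  have hSF : S ⊆ F := fun x hx => hx.1
  have hKD : ∀ t ∈ D, connectedComponentIn S t ⊆ D := fun t ht =>
    (connectedComponentIn_mono t hSF).trans (hsat t ht)
  have hSo : IsOpen S := by
    rw [hSdef, setOf_and, setOf_and]
    exact (isOpen_lt continuous_const (by fun_prop)).inter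
      ((isOpen_ne_fun (Polynomial.continuous_aeval g) continuous_const).inter
        (isOpen_ne_fun (Polynomial.continuous_aeval W) continuous_const))
  -- (i) the real roots of `P·g·W` and their number
  have hg : g ≠ 0 := g_ne_zero_of_wronskian_ne_zero hW
  set p : ℚ[X] := (X ^ 3 + C (A : ℚ) * X + C (B : ℚ)) * (g * W) with hpdef
  have hp : p ≠ 0 := mul_ne_zero (cubic_ne_zero A B) (mul_ne_zero hg hW)
  have hpeval : ∀ a : ℝ, aeval a p = (a ^ 3 + (A : ℝ) * a + (B : ℝ)) * (aeval a g * aeval a W) := by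
    intro a
    simp [hpdef, map_mul, map_add, map_pow, aeval_X]
  set R : Finset ℝ := (p.aroots ℝ).toFinset with hRdef
  have hmemR : ∀ a : ℝ, (a ^ 3 + (A : ℝ) * a + (B : ℝ)) * (aeval a g * aeval a W) = 0 → a ∈ R := by
    intro a ha
    rw [hRdef, Multiset.mem_toFinset, mem_aroots, hpeval]
    exact ⟨hp, ha⟩
  have hRcard : R.card + 1 ≤ 3 * max f.natDegree g.natDegree + 4 := by
    have hP3 : (X ^ 3 + C (A : ℚ) * X + C (B : ℚ) : ℚ[X]).natDegree ≤ 3 := by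
      refine (natDegree_add_le _ _).trans (max_le ((natDegree_add_le _ _).trans (max_le ?_ ?_)) ?_)
      · simp
      · exact (natDegree_C_mul_le _ _).trans (by simp)
      · simp
    have h1 : (derivative f * g).natDegree ≤ f.natDegree + g.natDegree :=
      natDegree_mul_le.trans
        (add_le_add ((natDegree_derivative_le f).trans (Nat.sub_le _ _)) le_rfl)
    have h2 : (f * derivative g).natDegree ≤ f.natDegree + g.natDegree :=
      natDegree_mul_le.trans
        (add_le_add le_rfl ((natDegree_derivative_le g).trans (Nat.sub_le _ _)))
    have h3 : W.natDegree ≤ max (derivative f * g).natDegree (f * derivative g).natDegree :=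
      natDegree_sub_le _ _
    have hpdeg : p.natDegree ≤ 3 + (g.natDegree + W.natDegree) :=
      natDegree_mul_le.trans (add_le_add hP3 natDegree_mul_le)
    have hRp : R.card ≤ p.natDegree := by
      refine (Multiset.toFinset_card_le _).trans ((card_roots' _).trans ?_)
      rw [natDegree_map]
    have := le_max_left f.natDegree g.natDegree
    have := le_max_right f.natDegree g.natDegree
    have := max_le h1 h2
    omega
  -- the frontier of the sheet set consists of roots of `P·g·W`
  have hRsub : closure S \ S ⊆ (R : Set ℝ) := by
    rintro a ⟨hac, haS⟩
    rw [Finset.mem_coe]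
    apply hmemR
    have hcl : IsClosed {x : ℝ | 0 ≤ x ^ 3 + (A : ℝ) * x + (B : ℝ)} :=
      isClosed_le continuous_const (by fun_prop)
    have hPa : 0 ≤ a ^ 3 + (A : ℝ) * a + (B : ℝ) :=
      closure_minimal (fun x hx => le_of_lt (show x ∈ S from hx).1) hcl hac
    rcases hPa.lt_or_eq with hpos | h0
    · have hgW : aeval a g * aeval a W = 0 := by
        by_contra hne
        exact haS ⟨hpos, (mul_ne_zero_iff.mp hne).1, (mul_ne_zero_iff.mp hne).2⟩
      rw [hgW, mul_zero]
    · rw [← h0, zero_mul]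
  -- (ii) the pieces: finitely many; a transversal `T` of those meeting `D`
  obtain ⟨hfin, hcnt⟩ := Dissection.finite_components hSo R hRsub
  set CompsD : Set (Set ℝ) := {K : Set ℝ | ∃ x ∈ S ∩ D, K = connectedComponentIn S x}
    with hCompsD
  have hsubC : CompsD ⊆ {K : Set ℝ | ∃ x ∈ S, K = connectedComponentIn S x} :=
    fun K ⟨x, hx, hK⟩ => ⟨x, hx.1, hK⟩
  have hfinD : CompsD.Finite := hfin.subset hsubC
  have hch : ∀ K ∈ CompsD, ∃ x ∈ S ∩ D, K = connectedComponentIn S x := fun K hK => hK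
  choose! pt hptSD hptK using hch
  set T : Finset ℝ := hfinD.toFinset.image pt with hTdef
  have hT1 : ∀ t ∈ T, t ∈ S ∩ D := by
    intro t ht
    obtain ⟨K, hK, rfl⟩ := Finset.mem_image.mp ht
    exact hptSD K (hfinD.mem_toFinset.mp hK)
  have hcov : ∀ x ∈ S, x ∈ D → ∃ t ∈ T, x ∈ connectedComponentIn S t := by
    intro x hxS hxD
    have hK : connectedComponentIn S x ∈ CompsD := ⟨x, ⟨hxS, hxD⟩, rfl⟩
    refine ⟨pt (connectedComponentIn S x),
      Finset.mem_image.mpr ⟨_, hfinD.mem_toFinset.mpr hK, rfl⟩, ?_⟩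
    rw [← hptK _ hK]
    exact mem_connectedComponentIn hxS
  have hdisjT : ∀ t ∈ T, ∀ t' ∈ T, t ≠ t' →
      connectedComponentIn S t ∩ connectedComponentIn S t' = ∅ := by
    intro t ht t' ht' hne
    obtain ⟨K, hK, rfl⟩ := Finset.mem_image.mp ht
    obtain ⟨K', hK', rfl⟩ := Finset.mem_image.mp ht'
    replace hK := hfinD.mem_toFinset.mp hK
    replace hK' := hfinD.mem_toFinset.mp hK'
    refine Set.disjoint_iff_inter_eq_empty.mp (Set.disjoint_left.mpr fun z hz hz' => hne ?_)
    have hKK' : K = K' := (hptK K hK).trans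
      (((connectedComponentIn_eq hz).trans (connectedComponentIn_eq hz').symm).trans
        (hptK K' hK').symm)
    rw [hKK']
  have hTcard : T.card ≤ 3 * max f.natDegree g.natDegree + 4 :=
    calc T.card ≤ hfinD.toFinset.card := Finset.card_image_le
      _ = CompsD.ncard := (Set.ncard_eq_toFinset_card CompsD hfinD).symm
      _ ≤ Set.ncard {K : Set ℝ | ∃ x ∈ S, K = connectedComponentIn S x} :=
          Set.ncard_le_ncard hsubC hfin
      _ ≤ R.card + 1 := hcnt
      _ ≤ 3 * max f.natDegree g.natDegree + 4 := hRcard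
  -- (iii) the restricted representations
  have hSsa : IsSemialgebraic ℚ {x : Fin 1 → ℝ | x 0 ∈ S} :=
    Dissection.isSemialgebraic_lift_sheet A B g W
  set ρ : ℝ → KZ.IntegralRep 1 := fun t =>
    r.restrict ({x : Fin 1 → ℝ | x 0 ∈ connectedComponentIn S t} ∩ r.domain)
      ((isSemialgebraic_hat_connectedComponentIn hSsa t).inter r.isSemialgebraic_domain)
      inter_subset_right with hρdef
  have hρD : ∀ t ∈ T, (ρ t).domain = {x : Fin 1 → ℝ | x 0 ∈ connectedComponentIn S t} := by
    intro t ht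
    show {x : Fin 1 → ℝ | x 0 ∈ connectedComponentIn S t} ∩ r.domain = _
    rw [inter_eq_left, hr]
    exact fun x hx => hKD t (hT1 t ht).2 hx
  have hU1sa : IsSemialgebraic ℚ (⋃ t ∈ T, (ρ t).domain) :=
    IsSemialgebraic.biUnion T _ fun t _ => (ρ t).isSemialgebraic_domain
  have hU1sub : (⋃ t ∈ T, (ρ t).domain) ⊆ r.domain :=
    iUnion₂_subset fun t _ => inter_subset_right
  set r₁ : KZ.IntegralRep 1 := r.restrict (⋃ t ∈ T, (ρ t).domain) hU1sa hU1sub with hr₁def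
  set r₀ : KZ.IntegralRep 1 := r.restrict (r.domain \ ⋃ t ∈ T, (ρ t).domain)
    (r.isSemialgebraic_domain.diff hU1sa) Set.sdiff_subset with hr₀def
  -- (iv) the moves: split off the cut set, kill it (it is finite), peel the pieces
  have hmove1 : KZ.ChainLE 1 1 (KZ.of r - KZ.of r₁ - KZ.of r₀) := by
    have hmem : KZ.of r - KZ.of r₁ - KZ.of r₀ ∈ KZ.domainAddRel :=
      ⟨1, r, r₁, r₀, (Set.union_sdiff_cancel hU1sub).symm, by
        show volume ((⋃ t ∈ T, (ρ t).domain) ∩ (r.domain \ ⋃ t ∈ T, (ρ t).domain)) = 0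
        rw [Set.inter_sdiff_self, measure_empty], fun _ _ => rfl, fun _ _ => rfl, rfl⟩
    exact KZ.ChainLE.of_mem_movesLE ⟨Or.inl (Or.inl (Or.inl hmem)),
      sub_mem (sub_mem (KZ.of_mem_formalRepLE r le_rfl) (KZ.of_mem_formalRepLE r₁ le_rfl))
        (KZ.of_mem_formalRepLE r₀ le_rfl)⟩
  have hZ : volume ((fun x : Fin 1 → ℝ => x 0) ⁻¹' (R : Set ℝ)) = 0 :=
    (R.finite_toSet.preimage fun x _ y _ hxy => _root_.funext fun i => by
      rw [Fin.fin_one_eq_zero i]; exact hxy).measure_zero _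
  have hmove2 : KZ.ChainLE 1 1 (KZ.of r₀) := by
    have hnull : volume (r₀.domain ∩ r₀.domain) = 0 := by
      rw [inter_self]
      refine measure_mono_null (fun x hx => ?_) hZ
      obtain ⟨hxr, hxU⟩ := (hx : x ∈ r.domain \ ⋃ t ∈ T, (ρ t).domain)
      have hxD : x ∈ {x : Fin 1 → ℝ | x 0 ∈ D} := hr ▸ hxr
      show x 0 ∈ (R : Set ℝ)
      rw [Finset.mem_coe]
      apply hmemR
      by_cases hxS : x 0 ∈ S
      · obtain ⟨t, ht, hxt⟩ := hcov (x 0) hxS hxD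
        exact absurd (mem_iUnion₂.mpr ⟨t, ht, show x ∈ (ρ t).domain from ⟨hxt, hxr⟩⟩) hxU
      · have hgW : aeval (x 0) g * aeval (x 0) W = 0 := by
          by_contra hne
          exact hxS ⟨hD hxD, (mul_ne_zero_iff.mp hne).1, (mul_ne_zero_iff.mp hne).2⟩
        rw [hgW, mul_zero]
    have hmem : -KZ.of r₀ ∈ KZ.domainAddRel :=
      ⟨1, r₀, r₀, r₀, (union_self _).symm, hnull, fun _ _ => rfl, fun _ _ => rfl, by abel⟩
    exact KZ.ChainLE.of_neg_mem_movesLE ⟨Or.inl (Or.inl (Or.inl hmem)),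
      neg_mem (KZ.of_mem_formalRepLE r₀ le_rfl)⟩
  have hpeel : KZ.ChainLE 1 (T.card + 1) (KZ.of r₁ - ∑ t ∈ T, KZ.of (ρ t)) := by
    refine Dissection.chainLE_sub_sum ρ T r₁ rfl (fun t ht t' ht' hne => ?_) fun t _ _ _ => rfl
    have h0 : (ρ t).domain ∩ (ρ t').domain ⊆ ∅ := by
      rintro x ⟨⟨hx1, -⟩, ⟨hx2, -⟩⟩
      have hx : x 0 ∈ connectedComponentIn S t ∩ connectedComponentIn S t' := ⟨hx1, hx2⟩
      rw [hdisjT t ht t' ht' hne] at hx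
      simp at hx
    rw [Set.eq_empty_of_subset_empty h0, measure_empty]
  refine ⟨T, ρ, fun t ht => ⟨(hT1 t ht).2, (hT1 t ht).1⟩, fun t ht => ⟨hρD t ht, rfl⟩, hTcard, ?_⟩
  have htot := (hmove1.add hmove2).add hpeel
  have e : KZ.of r - KZ.of r₁ - KZ.of r₀ + KZ.of r₀ + (KZ.of r₁ - ∑ t ∈ T, KZ.of (ρ t)) =
      KZ.of r - ∑ t ∈ T, KZ.of (ρ t) := by abel
  rw [e] at htot
  exact htot.mono le_rfl (by omega)

end Summit.KontsevichZagierPeriods.IsogenyCertificates.EffectiveXMapChainsLine
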